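import Mathlib
import HarnessLib
import Summits.ResolutionOfSingularities.ResolutionOfSingularities.Theorems.WildQuotientsWildQuotientResolutionS1aTerminalLocus

/-!
# S1a — (T0/T4 formal half) the `G`-action on the bad locus, its irreducible components and their generic points

[OURS · L1 W4.5c · lead-1 g6; STRATEGY-DESIGN v2 §6.2 «ν₁ and the component/generic-point API on Z»] — NOT statements
of the manuscript; counted 0; AI-level work, weaker than expert review. Crux stmt-ResolutionOfSingularities-17941, line
`s1a-logminvertex` v5, stub `stub_strategy`.

For a `G`-model `M` with bad locus `Z = M.badLocus` (`…S1aTerminalLocus`):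
* `autHomeo g : M.V ≃ₜ M.V`, `autHomeoBadLocus g : Z ≃ₜ Z` — the action as homeomorphisms (Z is `G`-stable);
* `image_mem_irreducibleComponents_badLocus` — `G` PERMUTES the irreducible components of `Z`;
* `irreducibleComponents_badLocus_nonempty` — a non-terminal model has a bad component;
* `isIrreducible_image_val` / `isClosed_image_val` / `exists_genericPoint_component` — a component of `Z`, read in `V`, is
  an irreducible closed subset with a generic point `η ∈ Z` (schemes are sober) — the points at which μ̂ʼs local
  components `(ν₃′, ν₂rev)` are to be read.
-/

set_option linter.dupNamespace false

noncomputable section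

open CategoryTheory AlgebraicGeometry TopologicalSpace Topology
open Literature.AlgebraicGeometry.Resolution Literature.AlgebraicGeometry.RelativeSpec
open Summit.ResolutionOfSingularities.ResolutionOfSingularities.Theorems.WildQuotientResolution.S1
open Summit.ResolutionOfSingularities.ResolutionOfSingularities.Theorems.WildQuotientResolution.S1.NodeAtlas

namespace Summit.ResolutionOfSingularities.ResolutionOfSingularities.Theorems.WildQuotientResolution.S1.GameFrame.GModel

variable {p : ℕ} {X' X₁ : Scheme.{0}} {q : X' ⟶ X₁} {G : Type} [Group G] {ρ : G →* Aut X'} {g₀ : G}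
  (M : GModel p q G ρ g₀)

/-! ## The action as homeomorphisms -/

/-- The action of `g` on `V` as a homeomorphism. -/
def autHomeo (g : G) : M.V ≃ₜ M.V := Scheme.homeoOfIso (M.act.aut g)

/-- Pointwise, `autHomeo g` is `(M.act.aut g).hom.base`. -/
@[simp] theorem autHomeo_apply (g : G) (v : M.V) : M.autHomeo g v = (M.act.aut g).hom.base v := rfl

/-- The action of `g` restricted to the (stable) bad locus, as a homeomorphism of `Z`. -/
def autHomeoBadLocus (g : G) : M.badLocus ≃ₜ M.badLocus :=
  (M.autHomeo g).subtype fun v => (M.aut_base_mem_badLocus_iff g v).symm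

/-- Pointwise, `autHomeoBadLocus g` is the action. -/
@[simp] theorem coe_autHomeoBadLocus_apply (g : G) (z : M.badLocus) :
    ((M.autHomeoBadLocus g z : M.badLocus) : M.V) = (M.act.aut g).hom.base z := rfl

/-! ## Components of the bad locus -/

/-- **`G` permutes the irreducible components of `Z(M)`.** [OURS · L1 W4.5c] -/
theorem image_mem_irreducibleComponents_badLocus (g : G) {C : Set M.badLocus}
    (hC : C ∈ irreducibleComponents M.badLocus) :
    (M.autHomeoBadLocus g) '' C ∈ irreducibleComponents M.badLocus :=
  image_mem_irreducibleComponents_of_isPreirreducible_fiber _ (M.autHomeoBadLocus g).continuous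
    (M.autHomeoBadLocus g).isOpenMap
    (fun _ => (Set.subsingleton_singleton.preimage (M.autHomeoBadLocus g).injective).isPreirreducible)
    (M.autHomeoBadLocus g).surjective hC

/-- `Z(M)` is non-empty iff the model is not terminal. -/
theorem badLocus_nonempty_iff : M.badLocus.Nonempty ↔ ¬ M.Terminal := by
  rw [terminal_iff_badLocus_eq_empty, Set.nonempty_iff_ne_empty]

/-- A non-terminal model has a bad irreducible component. -/
theorem irreducibleComponents_badLocus_nonempty (h : ¬ M.Terminal) : (irreducibleComponents M.badLocus).Nonempty := by
  obtain ⟨v, hv⟩ := M.badLocus_nonempty_iff.mpr h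
  exact ⟨_, irreducibleComponent_mem_irreducibleComponents (⟨v, hv⟩ : M.badLocus)⟩

/-- Every bad point lies in a bad irreducible component. -/
theorem exists_mem_irreducibleComponents_badLocus {v : M.V} (hv : v ∈ M.badLocus) :
    ∃ C ∈ irreducibleComponents M.badLocus, (⟨v, hv⟩ : M.badLocus) ∈ C :=
  ⟨_, irreducibleComponent_mem_irreducibleComponents _, mem_irreducibleComponent⟩

/-- A component of `Z`, read in `V`, is irreducible. -/
theorem isIrreducible_image_val {C : Set M.badLocus} (hC : C ∈ irreducibleComponents M.badLocus) :
    IsIrreducible (Subtype.val '' C : Set M.V) :=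
  hC.1.image _ continuous_subtype_val.continuousOn

/-- A component of `Z`, read in `V`, is closed (`Z` is closed). -/
theorem isClosed_image_val {C : Set M.badLocus} (hC : C ∈ irreducibleComponents M.badLocus) :
    IsClosed (Subtype.val '' C : Set M.V) :=
  M.isClosed_badLocus.isClosedEmbedding_subtypeVal.isClosedMap _ (isClosed_of_mem_irreducibleComponents C hC)

/-- A component of `Z`, read in `V`, lies in `Z`. -/
theorem image_val_subset_badLocus (C : Set M.badLocus) : (Subtype.val '' C : Set M.V) ⊆ M.badLocus := by
  rintro _ ⟨z, -, rfl⟩; exact z.2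

/-- **Generic points of bad components**: every irreducible component of `Z(M)` is the closure of a (generic) point of
`Z(M)` (schemes are sober). [OURS · L1 W4.5c] -/
theorem exists_genericPoint_component {C : Set M.badLocus} (hC : C ∈ irreducibleComponents M.badLocus) :
    ∃ η : M.V, η ∈ M.badLocus ∧ closure {η} = (Subtype.val '' C : Set M.V) := by
  have hirr := M.isIrreducible_image_val hC
  have hcl := M.isClosed_image_val hC
  have hη := hirr.isGenericPoint_genericPoint hcl
  exact ⟨hirr.genericPoint, M.image_val_subset_badLocus C hη.mem, hη⟩

/-- The generic point of a bad component is moved by `g` to the generic point of the image component. -/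
theorem closure_aut_base_eq_image {η : M.V} {C : Set M.badLocus} (hη : closure {η} = (Subtype.val '' C : Set M.V))
    (g : G) :
    closure {(M.act.aut g).hom.base η} = (Subtype.val '' ((M.autHomeoBadLocus g) '' C) : Set M.V) := by
  have h1 : closure {(M.act.aut g).hom.base η} = (M.autHomeo g) '' closure {η} := by
    rw [(M.autHomeo g).image_closure, Set.image_singleton]; rfl
  rw [h1, hη, Set.image_image, Set.image_image]
  rfl

end Summit.ResolutionOfSingularities.ResolutionOfSingularities.Theorems.WildQuotientResolution.S1.GameFrame.GModel

end
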